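import Summits.Ventures.PercRepro.RankLevelSetCycleStep
import Mathlib.Algebra.BigOperators.Group.Finset.Piecewise
import Mathlib.Data.Fintype.BigOperators

/-! # RankLevelSetCycleCount — KATONA'S CYCLE METHOD, PART 3: THE AVERAGING — RELABELLING SYMMETRY AND THE
FIBRE COUNTS OF (CYCLIC ORDER, START) PAIRS (night-1 g33; dossier §45)

The pairs `p = (σ, s)` with `σ : ZMod n ≃ α` a cyclic order and `s : ZMod n` a start are the universe of the
averaging. For a `k`-set `K` the FIBRE `fib n k K = {p : arc p.1 p.2 k = K}` has a cardinality independent of `K`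
(relabelling by a permutation of `α`: `card_fib_eq_of_card_eq`), and likewise the fibre `fib₂ n k L e` of a
«boundary pair» (`arc = L`, next element `e`) depends only on `#L` (`card_fib₂_eq`). THE TWO COUNTS: every pair has
exactly one `k`-arc, so `#fib n k K · C(n, k) = #(all pairs)` (**`card_fib_mul_choose`**), and the fibre of `K`
splits by the next element into `n − k` fibres `fib₂ n k K e`, `#fib n k K = (n − k) · #fib₂ n k K e₀`
(**`card_fib_eq_mul`**). THE SUMS OVER THE CYCLIC ORDERS of the per-cycle quantities of `RankLevelSetCycleStep`:
`Σ_σ #memberStarts V σ k = v_k · #fib n k K₀` (**`sum_card_memberStarts`**, `v_k = levelCount V k` the number of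
`k`-members of `V`), `Σ_σ #bdryL V σ k = #bdryPairs V k · #fib₂ n k K₀ e₀` (**`sum_card_bdryL`**, `bdryPairs V k` =
the pairs `(L, e)` with `#L = k`, `L ∉ V`, `e ∉ L`, `insert e L ∈ V`), and `Σ_σ #bdryR V σ k = Σ_σ #bdryL V σ k`
(**`sum_card_bdryR`**, by the reflection `(σ, s) ↦ (σ ∘ (−·), −s − k)` of the cycle). Every declaration has a
docstring; imports: the cell's `RankLevelSetCycleStep` and Mathlib only. Axioms: standard. -/

namespace PercRepro

namespace Cycle

open Finset

variable {α : Type} [Fintype α] [DecidableEq α] {n : ℕ} [NeZero n]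

/-- **The (cyclic order, start) pairs** of a type `α` with `n` elements: the universe of the averaging. -/
abbrev Pairs (α : Type) (n : ℕ) : Type := (ZMod n ≃ α) × ZMod n

/-! ## Relabelling -/

omit [DecidableEq α] [NeZero n] in
/-- Relabelling the cyclic order by a permutation `ρ` of `α` maps every arc to its image under `ρ`. -/
lemma arc_trans (σ : ZMod n ≃ α) (ρ : α ≃ α) (s : ZMod n) (k : ℕ) :
    arc (σ.trans ρ) s k = (arc σ s k).map ρ.toEmbedding := by
  ext x
  rw [Finset.mem_map_equiv, mem_arc, mem_arc, Equiv.symm_trans_apply]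

/-- **The relabelling bijection** on (cyclic order, start) pairs: `(σ, s) ↦ (σ.trans ρ, s)`. -/
def relabel (ρ : α ≃ α) : Pairs α n ≃ Pairs α n where
  toFun p := (p.1.trans ρ, p.2)
  invFun p := (p.1.trans ρ.symm, p.2)
  left_inv p := Prod.ext (Equiv.ext fun x => by simp) rfl
  right_inv p := Prod.ext (Equiv.ext fun x => by simp) rfl

omit [Fintype α] [DecidableEq α] [NeZero n] in
/-- The relabelling bijection, applied. -/
lemma relabel_apply (ρ : α ≃ α) (p : Pairs α n) : relabel ρ p = (p.1.trans ρ, p.2) := rfl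

/-- **Any injection on a finset extends to a permutation of `α`.** -/
lemma exists_perm_extend {K : Finset α} {f : α → α} (hf : Set.InjOn f K) :
    ∃ ρ : α ≃ α, ∀ x ∈ K, ρ x = f x := by
  have hαt : Fintype.card α = (univ : Finset α).card := Finset.card_univ.symm
  obtain ⟨g, hg⟩ := Finset.exists_equiv_extend_of_card_eq hαt (s := K) (f := f) (Finset.subset_univ _) hf
  refine ⟨g.trans (Equiv.subtypeUnivEquiv (fun x => Finset.mem_univ x)), fun x hx => ?_⟩
  rw [Equiv.trans_apply, Equiv.subtypeUnivEquiv_apply, hg x hx]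

omit [Fintype α] [DecidableEq α] [NeZero n] in
/-- A permutation that agrees on `L` with a bijection `L ≃ L'` maps `L` onto `L'`. -/
lemma map_eq_of_equiv {L L' : Finset α} (e : L ≃ L') (ρ : α ≃ α)
    (h : ∀ x (hx : x ∈ L), ρ x = (e ⟨x, hx⟩ : α)) : L.map ρ.toEmbedding = L' := by
  ext y
  rw [Finset.mem_map_equiv]
  constructor
  · intro hy
    have := h _ hy
    rw [Equiv.apply_symm_apply] at this
    rw [this]
    exact Finset.coe_mem _
  · intro hy
    obtain ⟨⟨x, hx⟩, hex⟩ := e.surjective ⟨y, hy⟩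
    have : ρ x = y := by rw [h x hx, hex]
    rw [← this, Equiv.symm_apply_apply]
    exact hx

/-- **For finsets of equal cardinality there is a permutation mapping one onto the other.** -/
lemma exists_perm_map_eq {K K' : Finset α} (h : K.card = K'.card) :
    ∃ ρ : α ≃ α, K.map ρ.toEmbedding = K' := by
  have e : K ≃ K' := Fintype.equivOfCardEq (by simp [h])
  let f : α → α := fun x => if hx : x ∈ K then (e ⟨x, hx⟩ : α) else x
  have hf : Set.InjOn f K := by
    intro x hx y hy hxy
    have hx' : x ∈ K := Finset.mem_coe.mp hx
    have hy' : y ∈ K := Finset.mem_coe.mp hy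
    simp only [f, dif_pos hx', dif_pos hy'] at hxy
    exact Subtype.ext_iff.mp (e.injective (Subtype.ext hxy))
  obtain ⟨ρ, hρ⟩ := exists_perm_extend hf
  exact ⟨ρ, map_eq_of_equiv e ρ fun x hx => by rw [hρ x hx]; simp [f, dif_pos hx]⟩

/-- **For a `k`-set plus a point there is a permutation mapping the set onto a given `k`-set and the point to a
given outside point.** -/
lemma exists_perm_map_eq_apply {L L' : Finset α} {e e' : α} (h : L.card = L'.card) (he : e ∉ L)
    (he' : e' ∉ L') : ∃ ρ : α ≃ α, L.map ρ.toEmbedding = L' ∧ ρ e = e' := by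
  have e₁ : L ≃ L' := Fintype.equivOfCardEq (by simp [h])
  let f : α → α := fun x => if x = e then e' else if hx : x ∈ L then (e₁ ⟨x, hx⟩ : α) else x
  have hfL : ∀ x (hx : x ∈ L), f x = (e₁ ⟨x, hx⟩ : α) := by
    intro x hx
    have hxe : x ≠ e := fun hxe => he (hxe ▸ hx)
    simp [f, hxe, dif_pos hx]
  have hf : Set.InjOn f ((insert e L : Finset α) : Set α) := by
    intro x hx y hy hxy
    rw [Finset.coe_insert, Set.mem_insert_iff, Finset.mem_coe] at hx hy
    rcases hx with rfl | hx <;> rcases hy with rfl | hy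
    · rfl
    · exfalso
      rw [hfL y hy] at hxy
      simp only [f, if_pos rfl] at hxy
      exact he' (hxy ▸ Finset.coe_mem _)
    · exfalso
      rw [hfL x hx] at hxy
      simp only [f, if_pos rfl] at hxy
      exact he' (hxy.symm ▸ Finset.coe_mem _)
    · rw [hfL x hx, hfL y hy] at hxy
      exact Subtype.ext_iff.mp (e₁.injective (Subtype.ext hxy))
  obtain ⟨ρ, hρ⟩ := exists_perm_extend hf
  refine ⟨ρ, map_eq_of_equiv e₁ ρ fun x hx => ?_, ?_⟩
  · rw [hρ x (Finset.mem_insert_of_mem hx), hfL x hx]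
  · rw [hρ e (Finset.mem_insert_self e L)]
    simp [f]

/-! ## The fibres -/

variable (n) in
/-- **The fibre of `K`**: the (cyclic order, start) pairs whose `k`-arc is `K`. -/
def fib (k : ℕ) (K : Finset α) : Finset (Pairs α n) :=
  univ.filter (fun p : Pairs α n => arc p.1 p.2 k = K)

variable (n) in
/-- **The fibre of a boundary pair `(L, e)`**: the pairs whose `k`-arc is `L` and whose next element is `e`. -/
def fib₂ (k : ℕ) (L : Finset α) (e : α) : Finset (Pairs α n) :=
  univ.filter (fun p : Pairs α n => arc p.1 p.2 k = L ∧ p.1 (p.2 + (k : ZMod n)) = e)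

/-- Relabelling carries the fibre of `K` onto the fibre of `K.map ρ`. -/
lemma card_fib_map (k : ℕ) (K : Finset α) (ρ : α ≃ α) :
    (fib n k (K.map ρ.toEmbedding)).card = (fib n k K).card := by
  symm
  apply Finset.card_equiv (relabel ρ)
  intro p
  simp only [fib, Finset.mem_filter, Finset.mem_univ, true_and, relabel_apply, arc_trans]
  exact (Finset.map_injective ρ.toEmbedding).eq_iff.symm

/-- **The fibre cardinality depends only on `#K`.** -/
lemma card_fib_eq_of_card_eq {k : ℕ} {K K' : Finset α} (h : K.card = K'.card) :
    (fib n k K).card = (fib n k K').card := by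
  obtain ⟨ρ, hρ⟩ := exists_perm_map_eq h
  rw [← hρ, card_fib_map]

/-- Relabelling carries the fibre of `(L, e)` onto the fibre of `(L.map ρ, ρ e)`. -/
lemma card_fib₂_map (k : ℕ) (L : Finset α) (e : α) (ρ : α ≃ α) :
    (fib₂ n k (L.map ρ.toEmbedding) (ρ e)).card = (fib₂ n k L e).card := by
  symm
  apply Finset.card_equiv (relabel ρ)
  intro p
  simp only [fib₂, Finset.mem_filter, Finset.mem_univ, true_and, relabel_apply, arc_trans,
    Equiv.trans_apply]
  rw [(Finset.map_injective ρ.toEmbedding).eq_iff, ρ.injective.eq_iff]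

/-- **The boundary-fibre cardinality depends only on `#L`.** -/
lemma card_fib₂_eq {k : ℕ} {L L' : Finset α} {e e' : α} (h : L.card = L'.card) (he : e ∉ L) (he' : e' ∉ L') :
    (fib₂ n k L e).card = (fib₂ n k L' e').card := by
  obtain ⟨ρ, hρ, hρe⟩ := exists_perm_map_eq_apply h he he'
  rw [← hρ, ← hρe, card_fib₂_map]

/-- **Every pair has one `k`-arc**: `#fib n k K · C(n, k) = #(all pairs)` for `#K = k ≤ n`. -/
lemma card_fib_mul_choose (hn : Fintype.card α = n) {k : ℕ} (hk : k ≤ n) {K : Finset α} (hK : K.card = k) :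
    (fib n k K).card * n.choose k = Fintype.card (Pairs α n) := by
  rw [← Finset.card_univ]
  have hmaps : ((univ : Finset (Pairs α n)) : Set _).MapsTo
      (fun p : Pairs α n => arc p.1 p.2 k) (((univ : Finset α).powersetCard k : Finset (Finset α)) : Set _) := by
    intro p _
    rw [Finset.mem_coe, Finset.mem_powersetCard]
    exact ⟨Finset.subset_univ _, card_arc _ _ hk⟩
  rw [Finset.card_eq_sum_card_fiberwise hmaps]
  have : ∀ K' ∈ (univ : Finset α).powersetCard k,
      ({p ∈ (univ : Finset (Pairs α n)) | arc p.1 p.2 k = K'}).card = (fib n k K).card := by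
    intro K' hK'
    exact card_fib_eq_of_card_eq (by rw [hK, (Finset.mem_powersetCard.mp hK').2])
  rw [Finset.sum_congr rfl this, Finset.sum_const, Finset.card_powersetCard, Finset.card_univ, hn,
    smul_eq_mul, mul_comm]

/-- **The fibre of `K` splits by the next element**: `#fib n k K = (n − k) · #fib₂ n k K e₀` for `e₀ ∉ K`, `k < n`. -/
lemma card_fib_eq_mul (hn : Fintype.card α = n) {k : ℕ} (hk : k < n) {K : Finset α} (hK : K.card = k)
    {e₀ : α} (he₀ : e₀ ∉ K) : (fib n k K).card = (n - k) * (fib₂ n k K e₀).card := by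
  have hmaps : ((fib n k K : Finset (Pairs α n)) : Set _).MapsTo
      (fun p : Pairs α n => p.1 (p.2 + (k : ZMod n))) (((univ \ K : Finset α)) : Set α) := by
    intro p hp
    rw [Finset.mem_coe, fib, Finset.mem_filter] at hp
    rw [Finset.mem_coe, Finset.mem_sdiff]
    exact ⟨Finset.mem_univ _, hp.2 ▸ apply_add_notMem_arc p.1 p.2 hk⟩
  rw [Finset.card_eq_sum_card_fiberwise hmaps]
  have : ∀ e ∈ univ \ K,
      ({p ∈ fib n k K | p.1 (p.2 + (k : ZMod n)) = e}).card = (fib₂ n k K e₀).card := by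
    intro e he
    have heq : {p ∈ fib n k K | p.1 (p.2 + (k : ZMod n)) = e} = fib₂ n k K e := by
      ext p; simp [fib, fib₂]
    rw [heq]
    exact card_fib₂_eq rfl (Finset.mem_sdiff.mp he).2 he₀
  rw [Finset.sum_congr rfl this, Finset.sum_const, Finset.card_sdiff_of_subset (Finset.subset_univ K),
    Finset.card_univ, hn, hK, smul_eq_mul]

/-! ## The sums over the cyclic orders -/

/-- **The level count** `v_k = #{W ∈ V : #W = k}`. -/
def levelCount (V : Finset (Finset α)) (k : ℕ) : ℕ := (V.filter (fun W => W.card = k)).card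

/-- **The boundary pairs at level `k`**: `(L, e)` with `#L = k`, `L ∉ V`, `e ∉ L` and `insert e L ∈ V`. -/
def bdryPairs (V : Finset (Finset α)) (k : ℕ) : Finset (Finset α × α) :=
  univ.filter (fun q : Finset α × α => q.1.card = k ∧ q.1 ∉ V ∧ q.2 ∉ q.1 ∧ insert q.2 q.1 ∈ V)

/-- A sum over the cyclic orders of counts of starts is a count of (cyclic order, start) pairs. -/
lemma sum_card_filter_eq (P : Pairs α n → Prop) [DecidablePred P] :
    ∑ σ : ZMod n ≃ α, (univ.filter (fun s => P (σ, s))).card = (univ.filter P).card := by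
  rw [Finset.card_filter, Fintype.sum_prod_type]
  simp only [Finset.card_filter]

/-- **`Σ_σ #memberStarts V σ k = v_k · #fib n k K₀`** for `#K₀ = k ≤ n`. -/
lemma sum_card_memberStarts (V : Finset (Finset α)) {k : ℕ} (hk : k ≤ n) {K₀ : Finset α}
    (hK₀ : K₀.card = k) :
    ∑ σ : ZMod n ≃ α, (memberStarts V σ k).card = levelCount V k * (fib n k K₀).card := by
  have h1 : ∑ σ : ZMod n ≃ α, (memberStarts V σ k).card =
      (univ.filter (fun p : Pairs α n => arc p.1 p.2 k ∈ V)).card :=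
    sum_card_filter_eq (fun p : Pairs α n => arc p.1 p.2 k ∈ V)
  rw [h1]
  have hmaps : ((univ.filter (fun p : Pairs α n => arc p.1 p.2 k ∈ V) : Finset (Pairs α n)) : Set _).MapsTo
      (fun p : Pairs α n => arc p.1 p.2 k) ((V.filter (fun W => W.card = k) : Finset (Finset α)) : Set _) := by
    intro p hp
    rw [Finset.mem_coe, Finset.mem_filter] at hp
    rw [Finset.mem_coe, Finset.mem_filter]
    exact ⟨hp.2, card_arc _ _ hk⟩
  rw [Finset.card_eq_sum_card_fiberwise hmaps]
  have : ∀ W ∈ V.filter (fun W => W.card = k),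
      ({p ∈ univ.filter (fun p : Pairs α n => arc p.1 p.2 k ∈ V) | arc p.1 p.2 k = W}).card =
        (fib n k K₀).card := by
    intro W hW
    rw [Finset.mem_filter] at hW
    have heq : {p ∈ univ.filter (fun p : Pairs α n => arc p.1 p.2 k ∈ V) | arc p.1 p.2 k = W} =
        fib n k W := by
      ext p
      simp only [fib, Finset.mem_filter, Finset.mem_univ, true_and]
      exact ⟨fun h => h.2, fun h => ⟨h ▸ hW.1, h⟩⟩
    rw [heq]
    exact card_fib_eq_of_card_eq (by rw [hW.2, hK₀])
  rw [Finset.sum_congr rfl this, Finset.sum_const, smul_eq_mul]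
  rfl

/-- **`Σ_σ #bdryL V σ k = #bdryPairs V k · #fib₂ n k K₀ e₀`** for `#K₀ = k < n`, `e₀ ∉ K₀`: the left boundary
starts of all cyclic orders are fibred over the boundary pairs `(L, e) = (arc, next element)`. -/
lemma sum_card_bdryL (V : Finset (Finset α)) {k : ℕ} (hk : k < n) {K₀ : Finset α} (hK₀ : K₀.card = k)
    {e₀ : α} (he₀ : e₀ ∉ K₀) :
    ∑ σ : ZMod n ≃ α, (bdryL V σ k).card = (bdryPairs V k).card * (fib₂ n k K₀ e₀).card := by
  have h1 : ∑ σ : ZMod n ≃ α, (bdryL V σ k).card =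
      (univ.filter (fun p : Pairs α n => arc p.1 p.2 k ∉ V ∧ arc p.1 p.2 (k + 1) ∈ V)).card :=
    sum_card_filter_eq (fun p : Pairs α n => arc p.1 p.2 k ∉ V ∧ arc p.1 p.2 (k + 1) ∈ V)
  rw [h1]
  have hmaps : ((univ.filter (fun p : Pairs α n => arc p.1 p.2 k ∉ V ∧ arc p.1 p.2 (k + 1) ∈ V) :
      Finset (Pairs α n)) : Set _).MapsTo
      (fun p : Pairs α n => (arc p.1 p.2 k, p.1 (p.2 + (k : ZMod n))))
      ((bdryPairs V k : Finset (Finset α × α)) : Set _) := by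
    intro p hp
    rw [Finset.mem_coe, Finset.mem_filter] at hp
    rw [Finset.mem_coe, bdryPairs, Finset.mem_filter]
    refine ⟨Finset.mem_univ _, card_arc _ _ hk.le, hp.2.1, apply_add_notMem_arc _ _ hk, ?_⟩
    rw [← arc_succ_eq_insert _ _ hk]
    exact hp.2.2
  rw [Finset.card_eq_sum_card_fiberwise hmaps]
  have : ∀ q ∈ bdryPairs V k,
      ({p ∈ univ.filter (fun p : Pairs α n => arc p.1 p.2 k ∉ V ∧ arc p.1 p.2 (k + 1) ∈ V) |
        (arc p.1 p.2 k, p.1 (p.2 + (k : ZMod n))) = q}).card = (fib₂ n k K₀ e₀).card := by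
    intro q hq
    rw [bdryPairs, Finset.mem_filter] at hq
    have heq : {p ∈ univ.filter (fun p : Pairs α n => arc p.1 p.2 k ∉ V ∧ arc p.1 p.2 (k + 1) ∈ V) |
        (arc p.1 p.2 k, p.1 (p.2 + (k : ZMod n))) = q} = fib₂ n k q.1 q.2 := by
      ext p
      simp only [fib₂, Finset.mem_filter, Finset.mem_univ, true_and, Prod.ext_iff]
      constructor
      · exact fun h => h.2
      · rintro ⟨h1, h2⟩
        refine ⟨⟨h1 ▸ hq.2.2.1, ?_⟩, h1, h2⟩
        rw [arc_succ_eq_insert _ _ hk, h1, h2]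
        exact hq.2.2.2.2
    rw [heq]
    exact card_fib₂_eq (by rw [hq.2.1, hK₀]) hq.2.2.2.1 he₀
  rw [Finset.sum_congr rfl this, Finset.sum_const, smul_eq_mul]

/-! ## The reflection of the cycle -/

/-- Reflection within a window: `((m − 1) − q).val < m ↔ q.val < m` for `m ≤ n`. -/
lemma val_natCast_sub_lt_iff {q : ZMod n} {m : ℕ} (hmn : m ≤ n) :
    (((m - 1 : ℕ) : ZMod n) - q).val < m ↔ q.val < m := by
  rcases Nat.eq_zero_or_pos m with rfl | hm
  · simp
  have key : ∀ r : ZMod n, r.val < m → (((m - 1 : ℕ) : ZMod n) - r).val < m := by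
    intro r hr
    have hm1 : ((m - 1 : ℕ) : ZMod n).val = m - 1 := ZMod.val_cast_of_lt (by omega)
    rw [ZMod.val_sub (by rw [hm1]; omega), hm1]
    omega
  constructor
  · intro h
    have := key _ h
    rwa [sub_sub_cancel] at this
  · exact key q

/-- **The reflection bijection** on (cyclic order, start) pairs at level `k`:
`(σ, s) ↦ (σ ∘ (−·), −s − k)`; it is an involution. -/
def reflectPair (k : ℕ) : Pairs α n ≃ Pairs α n where
  toFun p := ((Equiv.neg (ZMod n)).trans p.1, -p.2 - (k : ZMod n))
  invFun p := ((Equiv.neg (ZMod n)).trans p.1, -p.2 - (k : ZMod n))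
  left_inv p := Prod.ext (Equiv.ext fun x => by simp) (by simp)
  right_inv p := Prod.ext (Equiv.ext fun x => by simp) (by simp)

omit [Fintype α] [DecidableEq α] [NeZero n] in
/-- The reflection bijection, applied. -/
lemma reflectPair_apply (k : ℕ) (p : Pairs α n) :
    reflectPair k p = ((Equiv.neg (ZMod n)).trans p.1, -p.2 - (k : ZMod n)) := rfl

omit [DecidableEq α] in
/-- Under the reflection, the `k`-arc at the reflected start is the `k`-arc at `s + 1` (`k ≤ n`). -/
lemma arc_reflect (σ : ZMod n ≃ α) (s : ZMod n) {k : ℕ} (hk : k ≤ n) :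
    arc ((Equiv.neg (ZMod n)).trans σ) (-s - (k : ZMod n)) k = arc σ (s + 1) k := by
  rcases Nat.eq_zero_or_pos k with rfl | hk1
  · rw [arc_zero, arc_zero]
  ext x
  rw [mem_arc, mem_arc, Equiv.symm_trans_apply, Equiv.neg_symm, Equiv.neg_apply]
  have hrw : -σ.symm x - (-s - (k : ZMod n)) = ((k - 1 : ℕ) : ZMod n) - (σ.symm x - (s + 1)) := by
    rw [Nat.cast_sub hk1]; push_cast; ring
  rw [hrw]
  exact val_natCast_sub_lt_iff hk

omit [DecidableEq α] in
/-- Under the reflection, the `(k+1)`-arc at the reflected start is the `(k+1)`-arc at `s` (`k < n`). -/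
lemma arc_succ_reflect (σ : ZMod n ≃ α) (s : ZMod n) {k : ℕ} (hk : k < n) :
    arc ((Equiv.neg (ZMod n)).trans σ) (-s - (k : ZMod n)) (k + 1) = arc σ s (k + 1) := by
  ext x
  rw [mem_arc, mem_arc, Equiv.symm_trans_apply, Equiv.neg_symm, Equiv.neg_apply]
  have hrw : -σ.symm x - (-s - (k : ZMod n)) = ((k + 1 - 1 : ℕ) : ZMod n) - (σ.symm x - s) := by
    rw [Nat.add_sub_cancel]; ring
  rw [hrw]
  exact val_natCast_sub_lt_iff hk

/-- **`Σ_σ #bdryR V σ k = Σ_σ #bdryL V σ k`** (`k < n`): the reflection of the cycle exchanges the two boundary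
families. -/
lemma sum_card_bdryR (V : Finset (Finset α)) {k : ℕ} (hk : k < n) :
    ∑ σ : ZMod n ≃ α, (bdryR V σ k).card = ∑ σ : ZMod n ≃ α, (bdryL V σ k).card := by
  rw [show (∑ σ : ZMod n ≃ α, (bdryR V σ k).card) =
      (univ.filter (fun p : Pairs α n => arc p.1 (p.2 + 1) k ∉ V ∧ arc p.1 p.2 (k + 1) ∈ V)).card from
    sum_card_filter_eq (fun p : Pairs α n => arc p.1 (p.2 + 1) k ∉ V ∧ arc p.1 p.2 (k + 1) ∈ V)]
  rw [show (∑ σ : ZMod n ≃ α, (bdryL V σ k).card) =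
      (univ.filter (fun p : Pairs α n => arc p.1 p.2 k ∉ V ∧ arc p.1 p.2 (k + 1) ∈ V)).card from
    sum_card_filter_eq (fun p : Pairs α n => arc p.1 p.2 k ∉ V ∧ arc p.1 p.2 (k + 1) ∈ V)]
  apply Finset.card_equiv (reflectPair k)
  intro p
  simp only [Finset.mem_filter, Finset.mem_univ, true_and, reflectPair_apply]
  rw [arc_reflect _ _ hk.le, arc_succ_reflect _ _ hk]

end Cycle

end PercRepro
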